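import Summits.CriticalPhenomena.PercolationContinuityZ3.Theorems.SahiGridPatternOrderNSymmetric

/-!
# The order-`n` pattern functional is multi-additive: the PATTERN TENSOR (`sStarN` on singletons)

Support file (Sahi cell `prim-sahi`, seat `prim-sahi-typer`, generation 26; `--supports stmt-CriticalPhenomena-4575`).  Pure proofs
(one bookkeeping definition, the pattern tensor `patTensor`), no `sorry`, standard axioms.

The kernel `K_n(M)` is LINEAR IN EACH ROW (every monomial of the recursion uses each slot exactly once):
`copyKernel_update_lin`.  Hence the pattern functional is additive in each slot over disjoint unions (`sStarN_update_union`), vanishes on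
an empty slot, and expands over points:
  **`sStarN n d A = Σ_{x : Fin n → [n]^d, x_i ∈ A_i} patTensor x`**,  `patTensor x := sStarN n d (i ↦ {x_i})`   (`sStarN_eq_sum_patTensor`).
So `PatternPosN n d` is the statement that the integer array `patTensor` (the coefficient array of the homogeneous form `Z^n E_n` in the
Latin monomials; `(n^d)^n` entries, kernel-computable by `decide`) is nonnegative on products of up-set indicators — the form in which
slice / tensor certificates (as in the order-3 programme, `SahiGridPattern.slicePos_of_certCheck`) can be stated and checked at every order.
[this work]
-/

namespace Summit.CriticalPhenomena.PercolationContinuityZ3.Theorems.SahiGridPatternN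

open Finset Literature.Probability.LatticeModels
open SahiCopyKernel (copyKernel incMatrix mtail copyKernel_succ_succ copyKernel_one copyKernel_zero)
open scoped BigOperators

variable {n d : ℕ}

/-! ### Row-linearity of the kernel -/

section RowLinear

variable {R : Type*}

/-- Dropping slot/copy `0` ignores row `0`. [this work] -/
theorem mtail_update_zero {k : ℕ} (M : Fin (k + 1) → Fin (k + 1) → R) (r : Fin (k + 1) → R) :
    mtail (Function.update M 0 r) = mtail M := by
  funext j c
  simp only [mtail, Function.update_of_ne (Fin.succ_ne_zero j)]

/-- Dropping slot/copy `0` of a matrix updated in row `j+1` = updating row `j` of the tail. [this work] -/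
theorem mtail_update_succ {k : ℕ} (M : Fin (k + 1) → Fin (k + 1) → R) (j : Fin k) (r : Fin (k + 1) → R) :
    mtail (Function.update M j.succ r) = Function.update (mtail M) j (fun c => r c.succ) := by
  funext j' c
  by_cases h : j' = j
  · subst h; simp only [mtail, Function.update_self]
  · simp only [mtail, Function.update_of_ne h, Function.update_of_ne (fun e => h (Fin.succ_injective _ e))]

variable [CommRing R]

/-- **The kernel is linear in each row.** [this work] -/
theorem copyKernel_update_lin :
    ∀ (n : ℕ) (M : Fin n → Fin n → R) (i : Fin n) (r r' : Fin n → R) (a b : R),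
      copyKernel n (Function.update M i (fun c => a * r c + b * r' c)) =
        a * copyKernel n (Function.update M i r) + b * copyKernel n (Function.update M i r')
  | 0, M, i, _, _, _, _ => i.elim0
  | 1, M, i, r, r', a, b => by
      have hi : i = 0 := Subsingleton.elim _ _
      subst hi
      simp only [copyKernel_one, Function.update_self]
  | k + 2, M, i, r, r', a, b => by
      refine Fin.cases ?_ (fun j => ?_) i
      · -- row 0 (the distinguished slot)
        have hexp : ∀ ρ : Fin (k + 2) → R, copyKernel (k + 2) (Function.update M 0 ρ) =
            (∑ i' : Fin (k + 1), copyKernel (k + 1)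
              (Function.update (mtail M) i' (fun c => mtail M i' c * ρ c.succ))) -
              copyKernel (k + 1) (mtail M) * ρ 0 := by
          intro ρ
          rw [copyKernel_succ_succ, mtail_update_zero]
          simp only [Function.update_self]
        rw [hexp, hexp, hexp]
        have hterm : ∀ i' : Fin (k + 1),
            copyKernel (k + 1) (Function.update (mtail M) i' (fun c => mtail M i' c * (a * r c.succ + b * r' c.succ))) =
              a * copyKernel (k + 1) (Function.update (mtail M) i' (fun c => mtail M i' c * r c.succ)) +
                b * copyKernel (k + 1) (Function.update (mtail M) i' (fun c => mtail M i' c * r' c.succ)) := by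
          intro i'
          rw [← copyKernel_update_lin (k + 1) (mtail M) i' _ _ a b]
          congr 2; funext c; ring
        simp_rw [hterm]
        rw [Finset.sum_add_distrib, ← Finset.mul_sum, ← Finset.mul_sum]
        ring
      · -- row j.succ
        have hexp : ∀ ρ : Fin (k + 2) → R, copyKernel (k + 2) (Function.update M j.succ ρ) =
            (∑ i' : Fin (k + 1), copyKernel (k + 1)
              (Function.update (Function.update (mtail M) j (fun c => ρ c.succ)) i'
                (fun c => Function.update (mtail M) j (fun c => ρ c.succ) i' c * M 0 c.succ))) -
              copyKernel (k + 1) (Function.update (mtail M) j (fun c => ρ c.succ)) * M 0 0 := by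
          intro ρ
          rw [copyKernel_succ_succ, mtail_update_succ]
          simp only [Function.update_of_ne (Fin.succ_ne_zero j).symm]
        rw [hexp, hexp, hexp]
        -- the inner terms, slot by slot
        have hterm : ∀ i' : Fin (k + 1),
            copyKernel (k + 1) (Function.update (Function.update (mtail M) j (fun c => a * r c.succ + b * r' c.succ)) i'
                (fun c => Function.update (mtail M) j (fun c => a * r c.succ + b * r' c.succ) i' c * M 0 c.succ)) =
              a * copyKernel (k + 1) (Function.update (Function.update (mtail M) j (fun c => r c.succ)) i'
                    (fun c => Function.update (mtail M) j (fun c => r c.succ) i' c * M 0 c.succ)) +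
                b * copyKernel (k + 1) (Function.update (Function.update (mtail M) j (fun c => r' c.succ)) i'
                    (fun c => Function.update (mtail M) j (fun c => r' c.succ) i' c * M 0 c.succ)) := by
          intro i'
          by_cases hij : i' = j
          · subst hij
            simp only [Function.update_self, Function.update_idem]
            rw [← copyKernel_update_lin (k + 1) (mtail M) i' _ _ a b]
            congr 2; funext c; ring
          · simp only [Function.update_of_ne hij]
            simp only [Function.update_comm (Ne.symm hij)]
            exact copyKernel_update_lin (k + 1) _ j _ _ a b
        have hlast : copyKernel (k + 1) (Function.update (mtail M) j (fun c => a * r c.succ + b * r' c.succ)) =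
            a * copyKernel (k + 1) (Function.update (mtail M) j (fun c => r c.succ)) +
              b * copyKernel (k + 1) (Function.update (mtail M) j (fun c => r' c.succ)) :=
          copyKernel_update_lin (k + 1) (mtail M) j _ _ a b
        simp_rw [hterm]
        rw [hlast, Finset.sum_add_distrib, ← Finset.mul_sum, ← Finset.mul_sum]
        ring

/-- Additivity in a row. [this work] -/
theorem copyKernel_update_add (M : Fin n → Fin n → R) (i : Fin n) (r r' : Fin n → R) :
    copyKernel n (Function.update M i (fun c => r c + r' c)) =
      copyKernel n (Function.update M i r) + copyKernel n (Function.update M i r') := by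
  have h := copyKernel_update_lin n M i r r' 1 1
  simp only [one_mul] at h
  exact h

/-- Homogeneity in a row. [this work] -/
theorem copyKernel_update_smul (M : Fin n → Fin n → R) (i : Fin n) (a : R) (r : Fin n → R) :
    copyKernel n (Function.update M i (fun c => a * r c)) = a * copyKernel n (Function.update M i r) := by
  have h := copyKernel_update_lin n M i r r a 0
  simp only [zero_mul, add_zero] at h
  exact h

/-- **The kernel as a multilinear map in its rows.** [this work] -/
def copyKernelML (n : ℕ) : MultilinearMap R (fun _ : Fin n => Fin n → R) R where
  toFun M := copyKernel n M
  map_update_add' := by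
    intro inst M i x y
    obtain rfl : inst = instDecidableEqFin n := Subsingleton.elim _ _
    exact copyKernel_update_add M i x y
  map_update_smul' := by
    intro inst M i a x
    obtain rfl : inst = instDecidableEqFin n := Subsingleton.elim _ _
    exact copyKernel_update_smul M i a x

/-- Unfolding the multilinear packaging. [this work] -/
theorem copyKernelML_apply (M : Fin n → Fin n → R) : copyKernelML (R := R) n M = copyKernel n M := rfl

end RowLinear

/-! ### Additivity of `sStarN` in each slot; the pattern tensor -/

/-- The incidence matrix of a family updated in slot `i` by a disjoint union splits in row `i`. [this work] -/
theorem incMatrix_update_union (A : Fin n → Finset (Pn n d)) (i : Fin n) {S T : Finset (Pn n d)} (hST : Disjoint S T)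
    (p : Fin n → Pn n d) :
    incMatrix (Function.update A i (S ∪ T)) p =
      Function.update (incMatrix A p) i
        (fun c => incMatrix (Function.update A i S) p i c + incMatrix (Function.update A i T) p i c) := by
  funext j c
  by_cases hj : j = i
  · subst hj
    simp only [incMatrix, Function.update_self, Finset.mem_union]
    by_cases hS : p c ∈ S
    · have hT : p c ∉ T := Finset.disjoint_left.1 hST hS
      simp [hS, hT]
    · by_cases hT : p c ∈ T <;> simp [hS, hT]
  · simp only [incMatrix, Function.update_of_ne hj]

/-- Updating slot `i` of the family updates row `i` of the incidence matrix. [this work] -/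
theorem incMatrix_update (A : Fin n → Finset (Pn n d)) (i : Fin n) (S : Finset (Pn n d)) (p : Fin n → Pn n d) :
    incMatrix (Function.update A i S) p = Function.update (incMatrix A p) i (fun c => if p c ∈ S then 1 else 0) := by
  funext j c
  by_cases hj : j = i
  · subst hj; simp only [incMatrix, Function.update_self]
  · simp only [incMatrix, Function.update_of_ne hj]

/-- **`sStarN` is additive in each slot over disjoint unions.** [this work] -/
theorem sStarN_update_union (A : Fin n → Finset (Pn n d)) (i : Fin n) {S T : Finset (Pn n d)} (hST : Disjoint S T) :
    sStarN n d (Function.update A i (S ∪ T)) = sStarN n d (Function.update A i S) + sStarN n d (Function.update A i T) := by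
  unfold sStarN
  rw [← Finset.sum_add_distrib]
  refine Finset.sum_congr rfl fun π _ => ?_
  rw [incMatrix_update_union A i hST, incMatrix_update A i S, incMatrix_update A i T]
  simp only [Function.update_self]
  rw [← copyKernel_update_add]

/-- `sStarN` vanishes when a slot is updated to `∅`. [this work] -/
theorem sStarN_update_empty (A : Fin n → Finset (Pn n d)) (i : Fin n) : sStarN n d (Function.update A i ∅) = 0 :=
  sStarN_eq_zero_of_empty _ i (by simp)

/-- **Expansion of one slot over its points**: `sStarN (A with slot i = S) = Σ_{x ∈ S} sStarN (A with slot i = {x})`. [this work] -/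
theorem sStarN_update_eq_sum (A : Fin n → Finset (Pn n d)) (i : Fin n) (S : Finset (Pn n d)) :
    sStarN n d (Function.update A i S) = ∑ x ∈ S, sStarN n d (Function.update A i {x}) := by
  induction S using Finset.induction_on with
  | empty => rw [sStarN_update_empty, Finset.sum_empty]
  | @insert x S hx ih =>
      rw [Finset.sum_insert hx, ← ih, Finset.insert_eq, sStarN_update_union A i (Finset.disjoint_singleton_left.2 hx)]

/-- **The pattern tensor**: `sStarN` on a tuple of singletons. [this work] -/
def patTensor (n d : ℕ) (x : Fin n → Pn n d) : ℤ := sStarN n d fun i => {x i}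


/-- A row of the incidence matrix is the sum of the point rows over the slot: `[p c ∈ A_i] = Σ_{x ∈ A_i} [p c = x]`. [this work] -/
theorem incMatrix_eq_sum_pointRows (A : Fin n → Finset (Pn n d)) (p : Fin n → Pn n d) :
    incMatrix A p = fun i => ∑ x ∈ A i, (fun c => if p c = x then (1 : ℤ) else 0) := by
  funext i c
  rw [Finset.sum_apply]
  unfold incMatrix
  rw [Finset.sum_ite_eq (A i) (p c) (fun _ => (1 : ℤ))]

/-- The incidence matrix of a tuple of singletons. [this work] -/
theorem incMatrix_singletons (x : Fin n → Pn n d) (p : Fin n → Pn n d) :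
    incMatrix (fun i => ({x i} : Finset (Pn n d))) p = fun i c => if p c = x i then (1 : ℤ) else 0 := by
  funext i c
  simp only [incMatrix, Finset.mem_singleton]

/-- **The pattern functional is the pattern tensor summed over the box `∏ A_i`**:
`sStarN n d A = Σ_{x ∈ ∏_i A_i} patTensor n d x`. [this work] -/
theorem sStarN_eq_sum_patTensor (A : Fin n → Finset (Pn n d)) :
    sStarN n d A = ∑ x ∈ Fintype.piFinset A, patTensor n d x := by
  unfold patTensor sStarN
  rw [Finset.sum_comm]
  refine Finset.sum_congr rfl fun π _ => ?_
  rw [incMatrix_eq_sum_pointRows, ← copyKernelML_apply (R := ℤ), MultilinearMap.map_sum_finset]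
  refine Finset.sum_congr rfl fun x _ => ?_
  rw [copyKernelML_apply, incMatrix_singletons]

/-- Hence `PatternPosN n d` says: the pattern tensor is nonnegative on every box of up-sets. [this work] -/
theorem patternPosN_iff_patTensor :
    PatternPosN n d ↔ ∀ A : Fin n → Finset (Pn n d), (∀ i, IsUpperSet (A i : Set (Pn n d))) →
      0 ≤ ∑ x ∈ Fintype.piFinset A, patTensor n d x := by
  unfold PatternPosN
  simp_rw [sStarN_eq_sum_patTensor]

/-- The pattern tensor is symmetric under permuting the slots (from `sStarN_comp_perm`). [this work] -/
theorem patTensor_comp_perm (σ : Equiv.Perm (Fin n)) (x : Fin n → Pn n d) :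
    patTensor n d (fun i => x (σ i)) = patTensor n d x :=
  sStarN_comp_perm σ fun i => ({x i} : Finset (Pn n d))

end Summit.CriticalPhenomena.PercolationContinuityZ3.Theorems.SahiGridPatternN
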